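import Summits.BirchSwinnertonDyer.BirchSwinnertonDyer.Theorems.ManinLocalTwoThreePinningOneEightyRows
import Summits.BirchSwinnertonDyer.BirchSwinnertonDyer.Theorems.ManinLocalTwoThreeOddTwistRootFormTransport
import Summits.BirchSwinnertonDyer.BirchSwinnertonDyer.Theorems.ManinLocalTwoThreeEtaIdentitiesTwenty
import Literature.NumberTheory.EllipticCurves.OrdinaryPrimesProofs
import HarnessLib

/-!
# LEVEL 180 = 2²·3²·5 COMPLETE, fact-free: `|c| = 1` (hence `2 ∤ c` AND `3 ∤ c`) for every lattice-optimal `X₀(180)`-datum — a level in BOTH crux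
# domains, closed by the ODD-TWIST ROOT-FORM TRANSPORT from the fact-free root `20`

Cell bsd-f2-manin, route `ManinLocalTwoThree`, cruxes C2 `ManinOddAtFour` (stmt-BirchSwinnertonDyer-22967; `4 ∣ 180`) AND C3 `ManinPrimeToThreeAtNine`
(stmt-BirchSwinnertonDyer-22968; `9 ∥ 180`), prover seat p3 gen 26.  Inputs, all in the tree and all fact-free:
* an g56's pinning in `S₂(Γ₀(180))` + row (`…PinningOneEighty{Tables,TablesB,TablesC,,Rows}`, answering this seat's ask A-p3→an-180): for every
  `X₀(180)`-datum `D`, `D.f = φ₂₀ ⊗ χ₋₃` (`f_eq_charTwist_twenty'`; the one class `180a = 20a ⊗ χ₋₃`, EXPLICIT root `φ₂₀ = η₂²η₁₀² =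
  Literature…cuspFormEtaProductTwenty`);
* p2/p3's root `20` (`…EtaIdentitiesTwenty` / `…NeronSqueezeTwenty`: `periodLatticeLe_twenty : Λ(φ₂₀) ⊆ Λ(L₁)`, `L₁` a Néron pair of the globally minimal
  `W₂₀ = [−2, 0, −4, 0, 0]` of class `20a`, `Δ(W₂₀) = −6400`);
* THIS SEAT's engine (`…OddTwistRootFormTransport`): THEOREM 68.A WITHOUT A ROOT DATUM.

CONTENTS.  §1 `W₂₀` is good at `3` (`3 ∤ −6400`).  §2 THE HEADLINE **`abs_maninConstant_eq_one_oneEighty`**: `|c(D)| = 1` for every globally minimal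
elliptic `W/ℚ` and every `X₀(180)`-datum `D` with the lattice clause (`OddTwistRootForm.abs_maninConstant_eq_one_of_rootForm_charTwist_eq` at `p = 3`);
corollaries `not_dvd_maninConstant_oneEighty`, and BOTH crux shapes at `N = 180`: `maninOddAtFour_oneEighty` (`2² ∣ 180 ∧ ∀ …, |c| = 1 ∧ 2 ∤ c`),
`maninPrimeToThreeAtNine_oneEighty` (`3² ∣ 180 ∧ ∀ …, |c| = 1 ∧ 3 ∤ c`).

HONEST FRAMING: unconditional (standard axioms): no root datum, no modularity (`exists_isNewformOf`), no CDT, no printed Manin fact, no Cremona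
table.  It is ONE LEVEL of each crux domain; nothing here proves C2 or C3 (∀ N), Manin's conjecture or BSD; items 22967/22968 stay OPEN.
No definition, no named fact, no sorry.
[cite: Stevens1989, Lemma (5.2) p. 96, Lemma (5.4) p. 97] [cite: Shimura1971, Prop. 3.64] [cite: AgasheRibetStein2006, §§1–2]
[cite: CremonaAlgorithms1997, §2.10 and Table 1 (20a, 180a1)] [cite: SilvermanAEC2009, VII.5 Prop. 5.1]
-/

set_option autoImplicit false
-- lint-debt: the directory name repeats the summit name (sibling precedent `ManinLocalTwoThreeManinConstantOneTwentySix.lean`)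
set_option linter.dupNamespace false

noncomputable section

open Complex
open UpperHalfPlane hiding I
open scoped MatrixGroups ModularForm
open ModularForm CongruenceSubgroup
open Literature.NumberTheory.ModularForms
open Literature.NumberTheory.EllipticCurves Literature.NumberTheory.EllipticCurves.ModularForms

namespace Summit.BirchSwinnertonDyer.BirchSwinnertonDyer.Theorems.ManinLocalTwoThree.LevelOneEighty

open Summit.BirchSwinnertonDyer.BirchSwinnertonDyer.Theorems.ManinLocalTwoThree
open PinningKernel PinningOneEighty OddTwistRootForm

/-! ## §1 The root curve `W₂₀ = [−2, 0, −4, 0, 0]` (class `20a`) is good at `3` -/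

/-- `Δ_min(W₂₀) = −6400 = −2⁸·5²`. [cite: CremonaAlgorithms1997, Table 1 (20a)] -/
theorem minimalDiscriminantInt_W20 [(⟨-2, 0, -4, 0, 0⟩ : WeierstrassCurve ℚ).IsGloballyMinimal] :
    WeierstrassCurve.minimalDiscriminantInt (⟨-2, 0, -4, 0, 0⟩ : WeierstrassCurve ℚ) = -6400 := by
  have h : ((WeierstrassCurve.minimalDiscriminantInt (⟨-2, 0, -4, 0, 0⟩ : WeierstrassCurve ℚ) : ℤ) : ℚ) = ((-6400 : ℤ) : ℚ) := by
    rw [WeierstrassCurve.cast_minimalDiscriminantInt, NeronSqueezeTwenty.Δ_W20]; norm_num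
  exact_mod_cast h

/-- **`W₂₀` has good reduction at `3`** (`3 ∤ Δ_min = −2⁸·5²`). [cite: SilvermanAEC2009, VII.5 Prop. 5.1] -/
theorem hasGoodReductionAtPrime_three_W20 [Fact (Nat.Prime 3)] [(⟨-2, 0, -4, 0, 0⟩ : WeierstrassCurve ℚ).IsGloballyMinimal] :
    (⟨-2, 0, -4, 0, 0⟩ : WeierstrassCurve ℚ).HasGoodReductionAtPrime 3 := by
  refine WeierstrassCurve.hasGoodReductionAtPrime_of_not_dvd _ 3 ?_
  rw [minimalDiscriminantInt_W20]
  decide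

/-! ## §2 The headline: `|c| = 1` on `X₀(180)`, unconditionally -/

/-- **LEVEL 180 COMPLETE — `|c| = 1` for every globally minimal elliptic `W/ℚ` and every `X₀(180)`-datum with the lattice clause** (the shape
`LevelManinOne 180`): `D.f = φ₂₀ ⊗ χ₋₃` (an g56), root squeeze `Λ(φ₂₀) ⊆ Λ_Néron(W₂₀)` (p2/p3), `W₂₀` good at `3`, odd-twist ROOT-FORM transport
(Stevens (5.2) PROVED + `Γ₀` twisting + Néron squeeze).  No root datum, no modularity, no CDT, no printed fact.
[cite: Stevens1989, Lemma (5.2) p. 96, Lemma (5.4) p. 97] [cite: AgasheRibetStein2006, §§1–2] [cite: CremonaAlgorithms1997, Table 1 (180a1)] -/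
theorem abs_maninConstant_eq_one_oneEighty (W : WeierstrassCurve ℚ) [W.IsElliptic] [W.IsGloballyMinimal]
    (D : ModularParametrizationData W 180) (hopt : ∀ z ∈ D.L.lattice, ∃ w ∈ periodLattice D.f, z = D.c * w) :
    |D.maninConstant| = 1 := by
  haveI h3 : Fact (Nat.Prime 3) := ⟨by norm_num⟩
  obtain ⟨L₁, hg2, hg3, hle⟩ := EtaIdentitiesTwenty.periodLatticeLe_twenty
  haveI := NeronSqueezeTwenty.isElliptic_W20
  haveI := NeronSqueezeTwenty.isGloballyMinimal_W20
  exact abs_maninConstant_eq_one_of_rootForm_charTwist_eq (p := 3) (by norm_num) (isQuadratic_quadraticChar_ringHomComp 3)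
    (isPrimitive_quadraticChar_ringHomComp 3 (by norm_num)) cuspFormEtaProductTwenty (⟨-2, 0, -4, 0, 0⟩ : WeierstrassCurve ℚ) L₁
    (NeronSqueezeTwenty.isNeronLatticeOf_W20 hg2 hg3) hle (Or.inl hasGoodReductionAtPrime_three_W20) W D _ _
    (f_eq_charTwist_twenty' D) hopt

/-- **Corollary: no integer `p` with `|p| ≠ 1` — in particular neither `2` nor `3` nor any prime — divides the Manin constant of a
lattice-optimal `X₀(180)`-datum.** [folklore] -/
theorem not_dvd_maninConstant_oneEighty (W : WeierstrassCurve ℚ) [W.IsElliptic] [W.IsGloballyMinimal]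
    (D : ModularParametrizationData W 180) (hopt : ∀ z ∈ D.L.lattice, ∃ w ∈ periodLattice D.f, z = D.c * w)
    {p : ℤ} (hp : p.natAbs ≠ 1) : ¬ p ∣ D.maninConstant := by
  intro h
  have h1 := abs_maninConstant_eq_one_oneEighty W D hopt
  have hn : D.maninConstant.natAbs = 1 := by
    rw [Int.abs_eq_natAbs] at h1
    exact_mod_cast h1
  have h2 : p.natAbs ∣ 1 := hn ▸ Int.natAbs_dvd_natAbs.mpr h
  exact hp (Nat.dvd_one.mp h2)

/-- **C2 `ManinOddAtFour` AT THE LEVEL `N = 180`, with NONE of its printed hypotheses**: `2² ∣ 180` and every lattice-optimal `X₀(180)`-datum of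
every globally minimal elliptic curve has `|c| = 1` and `2 ∤ c`. [cite: CremonaAlgorithms1997, Table 1 (180a1)] -/
theorem maninOddAtFour_oneEighty : 2 ^ 2 ∣ 180 ∧
    ∀ (W : WeierstrassCurve ℚ) [W.IsElliptic] [W.IsGloballyMinimal] (D : ModularParametrizationData W 180),
      (∀ z ∈ D.L.lattice, ∃ w ∈ periodLattice D.f, z = D.c * w) →
        |D.maninConstant| = 1 ∧ ¬ (2 : ℤ) ∣ D.maninConstant :=
  ⟨by norm_num, fun W _ _ D hopt ↦
    ⟨abs_maninConstant_eq_one_oneEighty W D hopt, not_dvd_maninConstant_oneEighty W D hopt (by decide)⟩⟩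

/-- **C3 `ManinPrimeToThreeAtNine` AT THE LEVEL `N = 180`, with NONE of its printed hypotheses**: `3² ∣ 180` and every lattice-optimal
`X₀(180)`-datum of every globally minimal elliptic curve has `|c| = 1` and `3 ∤ c`. [cite: CremonaAlgorithms1997, Table 1 (180a1)] -/
theorem maninPrimeToThreeAtNine_oneEighty : 3 ^ 2 ∣ 180 ∧
    ∀ (W : WeierstrassCurve ℚ) [W.IsElliptic] [W.IsGloballyMinimal] (D : ModularParametrizationData W 180),
      (∀ z ∈ D.L.lattice, ∃ w ∈ periodLattice D.f, z = D.c * w) →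
        |D.maninConstant| = 1 ∧ ¬ (3 : ℤ) ∣ D.maninConstant :=
  ⟨by norm_num, fun W _ _ D hopt ↦
    ⟨abs_maninConstant_eq_one_oneEighty W D hopt, not_dvd_maninConstant_oneEighty W D hopt (by decide)⟩⟩

/-- **The additive primes read back**: every curve carrying an `X₀(180)`-datum has `a₂(W) = 0` and `a₃(W) = 0` (additive at `2` and `3` in the
`L`-coefficient sense) and `a₅(W) = 1`. [cite: CremonaAlgorithms1997, Table 1 (180a1)] -/
theorem lFunction_two_three_five (W : WeierstrassCurve ℚ) [W.IsElliptic] (D : ModularParametrizationData W 180) :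
    W.LFunction 2 = 0 ∧ W.LFunction 3 = 0 ∧ W.LFunction 5 = 1 := by
  have h := (f_eq_charTwist_twenty D).1
  have h2 := congrArg (fun l : List (ℕ × ℤ) ↦ (l.getD 0 (0, 0)).2) h
  have h3 := congrArg (fun l : List (ℕ × ℤ) ↦ (l.getD 1 (0, 0)).2) h
  have h5 := congrArg (fun l : List (ℕ × ℤ) ↦ (l.getD 2 (0, 0)).2) h
  exact ⟨by simpa [truth, rowA] using h2, by simpa [truth, rowA] using h3, by simpa [truth, rowA] using h5⟩

end Summit.BirchSwinnertonDyer.BirchSwinnertonDyer.Theorems.ManinLocalTwoThree.LevelOneEighty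

end
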